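import Mathlib.NumberTheory.ModularForms.JacobiTheta.TwoVariable
import Literature.NumberTheory.EllipticCurves.HalfIntegralWeightForms
import Literature.NumberTheory.EllipticCurves.HalfIntegralWeightGaussSums
import HarnessLib

/-!
# The transformation law of `θ(z) = ∑ e^{2πi n² z}` under `SL₂(ℤ)` (Poisson summation)

For `γ = (a b; c d) ∈ SL₂(ℤ)` with `c > 0` and `z ∈ ℍ` we PROVE the classical formula
(Shimura 1973, §1; Koblitz GTM 97, III §3 and IV §1; Iwaniec, *Topics*, §10.?)

  `θ(γz) = (2ic/(cz + d))^{-1/2} ∑_{k ∈ ℤ} exp(πi k² (cz + d)/(2c)) G(a, k; c)`      (★)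

(`shimuraTheta_smul_eq_tsum`), where `G(a, k; c) = ∑_{r mod c} e((a r² + k r)/c)` is the quadratic
Gauss sum of `HalfIntegralWeightGaussSums` and `u^{-1/2} = 1/u^{1/2}` is the principal branch
(`Re (2ic/(cz+d)) > 0`). The proof: `γz = a/c - 1/(c(cz+d))`; split `n = cm + r`; the inner sum
over `m` is `∑_m exp(πi τ (m + r/c)²)`, `τ = -2c/(cz+d) ∈ ℍ`, to which Mathlib's functional equation
of the two-variable Jacobi theta function (`jacobiTheta₂_functional_equation`, i.e. Poisson
summation) applies (`hasSum_cexp_sq_add`); regrouping the resulting double sum by `k` produces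
the Gauss sums. For `γ ∈ Γ₀(4)` (`4 ∣ c`) the odd `k` drop out and the even ones complete the
square (`HalfIntegralWeightGaussSums`), giving the **theta multiplier with unevaluated Gauss sum**

  `θ(γz) = (2ic/(cz + d))^{-1/2} G(a; c) θ(z)`                                        (★★)

(`shimuraTheta_smul_eq_of_four_dvd`). Evaluating `G(a; c) = ε_a⁻¹… (c/a) √(2ic)`-type signs is NOT
done here; (★★) with `|G(a; c)|² = 2c` and the algebra of Gauss sums suffices for the automorphy of
theta products (sequel files). Also recorded: `hasSum_shimuraTheta` (the `q`-series of `θ` as a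
`HasSum`), the coordinate formula `coe_smul_eq'` for the action of `SL₂(ℤ)`, and
`summable_thetaTransform` / `norm_thetaTransform_le` (absolute convergence of the series in (★) with
the bound `|term_k| ≤ c exp(-π k² Im(cz+d)/(2c))`).

## References

* G. Shimura, *On modular forms of half integral weight*, Ann. of Math. 97 (1973) 440–481, §1.
* N. Koblitz, *Introduction to Elliptic Curves and Modular Forms*, GTM 97 (1993), III §3, IV §1.
* D. Mumford, *Tata Lectures on Theta I* (1983), §7 (theta transformation via Poisson summation).
-/

noncomputable section

open scoped MatrixGroups

open UpperHalfPlane hiding I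
open Complex Filter Topology

namespace Literature.NumberTheory.EllipticCurves.ModularForms

/-! ### The `q`-series of `θ` and a Poisson summation lemma -/

/-- `θ(z) = ∑_{n ∈ ℤ} e^{2πi n² z}` as a convergent series (`HasSum`). [folklore] -/
theorem hasSum_shimuraTheta (z : ℍ) :
    HasSum (fun n : ℤ ↦ cexp (2 * Real.pi * I * n ^ 2 * (z : ℂ))) (shimuraTheta z) := by
  have h2 : 0 < (2 * (z : ℂ)).im := by simpa using z.im_pos
  have h := hasSum_jacobiTheta₂_term 0 h2
  rw [← jacobiTheta_eq_jacobiTheta₂] at h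
  unfold shimuraTheta
  convert h using 2 with n
  rw [jacobiTheta₂_term]
  congr 1
  ring

/-- **Poisson summation for a shifted Gaussian sum** (from Mathlib's functional equation of the
two-variable Jacobi theta function): for `Im τ > 0` and `x ∈ ℂ`,
`∑_{m ∈ ℤ} exp(πi τ (m + x)²) = (-iτ)^{-1/2} ϑ(x, -1/τ) = (-iτ)^{-1/2} ∑_k exp(2πi k x - πi k²/τ)`.
[folklore] -/
theorem hasSum_cexp_sq_add {τ : ℂ} (hτ : 0 < τ.im) (x : ℂ) :
    HasSum (fun m : ℤ ↦ cexp (Real.pi * I * τ * (m + x) ^ 2))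
      (1 / (-I * τ) ^ (1 / 2 : ℂ) * jacobiTheta₂ x (-1 / τ)) := by
  have hτ0 : τ ≠ 0 := by rintro rfl; simp at hτ
  have h := (hasSum_jacobiTheta₂_term (x * τ) hτ).mul_left (cexp (Real.pi * I * τ * x ^ 2))
  have hf : (fun m : ℤ ↦ cexp (Real.pi * I * τ * (m + x) ^ 2)) =
      fun m : ℤ ↦ cexp (Real.pi * I * τ * x ^ 2) * jacobiTheta₂_term m (x * τ) τ := by
    funext m
    rw [jacobiTheta₂_term, ← Complex.exp_add]
    congr 1
    ring
  have hv : cexp (Real.pi * I * τ * x ^ 2) * jacobiTheta₂ (x * τ) τ =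
      1 / (-I * τ) ^ (1 / 2 : ℂ) * jacobiTheta₂ x (-1 / τ) := by
    rw [jacobiTheta₂_functional_equation, mul_div_cancel_right₀ x hτ0]
    have e2 : -Real.pi * I * (x * τ) ^ 2 / τ = -(Real.pi * I * τ * x ^ 2) := by
      field_simp
    rw [e2, Complex.exp_neg]
    have hA : cexp (Real.pi * I * τ * x ^ 2) ≠ 0 := Complex.exp_ne_zero _
    field_simp
  rw [hf, ← hv]
  exact h

/-! ### Coordinates for the action of `SL₂(ℤ)` -/

/-- `↑(γ • z) = (a z + b)/(c z + d)` for `γ = (a b; c d) ∈ SL₂(ℤ)`. [folklore] -/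
theorem coe_smul_eq' (γ : SL(2, ℤ)) (z : ℍ) :
    ((γ • z : ℍ) : ℂ) = ((γ 0 0 : ℂ) * z + γ 0 1) / ((γ 1 0 : ℂ) * z + γ 1 1) := by
  rw [UpperHalfPlane.specialLinearGroup_apply]
  simp

/-- `a d - b c = 1` for `γ = (a b; c d) ∈ SL₂(ℤ)`. [folklore] -/
theorem det_eq_one' (γ : SL(2, ℤ)) : (γ 0 0 : ℤ) * γ 1 1 - γ 0 1 * γ 1 0 = 1 := by
  have := γ.det_coe
  rw [Matrix.det_fin_two] at this
  linear_combination this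

/-- `Im (c z + d) = c Im z` for real `c, d`; in particular `> 0` for `c > 0`. [folklore] -/
theorem im_denom_pos {c : ℕ} [NeZero c] (d : ℤ) (z : ℍ) : 0 < ((c : ℂ) * z + d).im := by
  have : ((c : ℂ) * z + d).im = c * z.im := by simp
  rw [this]
  exact mul_pos (Nat.cast_pos.mpr (Nat.pos_of_ne_zero (NeZero.ne c))) z.im_pos

/-- `(a z + b)/(c z + d) = a/c - 1/(c (cz + d))` when `ad - bc = 1`, `c ≠ 0`, `cz + d ≠ 0`.
[folklore] -/
theorem moebius_eq_sub_inv' {a b c d : ℂ} (hc : c ≠ 0) (h1 : a * d - b * c = 1) {z : ℂ}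
    (hz : c * z + d ≠ 0) : (a * z + b) / (c * z + d) = a / c - 1 / (c * (c * z + d)) := by
  rw [div_sub_div _ _ hc (mul_ne_zero hc hz), div_eq_div_iff hz (mul_ne_zero hc (mul_ne_zero hc hz))]
  linear_combination (-(c * (c * z + d))) * h1

/-- Splitting a series over `ℤ` into even and odd indices (the `ℤ`-analogue of Mathlib's
`HasSum.even_add_odd`). [folklore] -/
theorem hasSum_int_even_add_odd {M : Type*} [AddCommMonoid M] [TopologicalSpace M]
    [ContinuousAdd M] {f : ℤ → M} {m m' : M} (he : HasSum (fun k ↦ f (2 * k)) m)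
    (ho : HasSum (fun k ↦ f (2 * k + 1)) m') : HasSum f (m + m') := by
  have hinj := mul_right_injective₀ (two_ne_zero' ℤ)
  replace ho := ((add_left_injective 1).comp hinj).hasSum_range_iff.2 ho
  refine (hinj.hasSum_range_iff.2 he).add_isCompl ?_ ho
  have h1 : Set.range (fun x : ℤ ↦ 2 * x) = {n : ℤ | Even n} := by
    ext n
    simp only [Set.mem_range, Set.mem_setOf_eq, Even]
    constructor
    · rintro ⟨r, rfl⟩; exact ⟨r, two_mul r⟩
    · rintro ⟨r, rfl⟩; exact ⟨r, two_mul r⟩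
  have h2 : Set.range ((fun x : ℤ ↦ x + 1) ∘ fun x : ℤ ↦ 2 * x) = {n : ℤ | Odd n} := by
    ext n
    simp only [Set.mem_range, Function.comp_apply, Set.mem_setOf_eq, Odd]
    constructor
    · rintro ⟨r, rfl⟩; exact ⟨r, rfl⟩
    · rintro ⟨r, rfl⟩; exact ⟨r, rfl⟩
  rw [h1, h2]
  exact Int.isCompl_even_odd

/-! ### The transformation law -/

section Transform

variable {c : ℕ} [NeZero c]

/-- The terms of the series in (★) are bounded by `c exp(-π k² Im(w)/(2c))`, `w = cz + d`.
[folklore] -/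
theorem norm_thetaTransform_le (a : ZMod c) (w : ℂ) (k : ℤ) :
    ‖cexp (Real.pi * I * k ^ 2 * (w / (2 * c))) * quadGaussSum c a k‖ ≤
      c * ‖jacobiTheta₂_term k 0 (w / (2 * c))‖ := by
  rw [norm_mul, mul_comm]
  refine mul_le_mul (norm_quadGaussSum_le a k) (le_of_eq ?_) (norm_nonneg _) (Nat.cast_nonneg c)
  rw [jacobiTheta₂_term]
  congr 2
  ring

/-- `Im (w/(2c)) > 0` when `Im w > 0`. [folklore] -/
theorem im_div_two_mul_pos {w : ℂ} (hw : 0 < w.im) : 0 < (w / (2 * c)).im := by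
  have hc' : (0 : ℝ) < c := Nat.cast_pos.mpr (Nat.pos_of_ne_zero (NeZero.ne c))
  rw [show w / (2 * c) = w / ((2 * c : ℝ) : ℂ) by norm_cast, Complex.div_ofReal_im]
  positivity

/-- The series in (★) converges absolutely (`Im w > 0`). [folklore] -/
theorem summable_thetaTransform (a : ZMod c) {w : ℂ} (hw : 0 < w.im) :
    Summable (fun k : ℤ ↦ cexp (Real.pi * I * k ^ 2 * (w / (2 * c))) * quadGaussSum c a k) := by
  have hw' : 0 < (w / (2 * c)).im := im_div_two_mul_pos hw
  refine Summable.of_norm_bounded (g := fun k : ℤ ↦ (c : ℝ) * ‖jacobiTheta₂_term k 0 (w / (2 * c))‖)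
    (((summable_jacobiTheta₂_term_iff 0 _).mpr hw').norm.mul_left _) (norm_thetaTransform_le a w)

/-- **The transformation law of `θ` under `SL₂(ℤ)` (★).** For `γ = (a b; c d) ∈ SL₂(ℤ)` with
`c > 0` and `z ∈ ℍ`,
`θ(γz) = (2ic/(cz + d))^{-1/2} ∑_{k ∈ ℤ} exp(πi k² (cz + d)/(2c)) G(a, k; c)`,
`G(a, k; c) = ∑_{r mod c} e((a r² + k r)/c)` (Poisson summation on the classes `n ≡ r (mod c)` of
`θ(γz) = ∑_n e(a n²/c) e(-n²/(c(cz + d)))`). [cite: Shimura1973HalfIntegral, §1]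
[cite: KoblitzECMF1993, Ch. III §3 and Ch. IV §1] -/
theorem shimuraTheta_smul_eq_tsum {γ : SL(2, ℤ)} (hc : (γ 1 0 : ℤ) = c) (z : ℍ) :
    shimuraTheta (γ • z) =
      1 / (2 * I * c / ((c : ℂ) * z + γ 1 1)) ^ (1 / 2 : ℂ) *
        ∑' k : ℤ, cexp (Real.pi * I * k ^ 2 * (((c : ℂ) * z + γ 1 1) / (2 * c))) *
          quadGaussSum c (γ 0 0) k := by
  -- notation
  set a : ℤ := γ 0 0 with ha
  set b : ℤ := γ 0 1 with hb
  set d : ℤ := γ 1 1 with hd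
  set w : ℂ := (c : ℂ) * z + d with hw
  have hc0 : (c : ℂ) ≠ 0 := Nat.cast_ne_zero.mpr (NeZero.ne c)
  have hcR : (0 : ℝ) < c := Nat.cast_pos.mpr (Nat.pos_of_ne_zero (NeZero.ne c))
  have hw_im : 0 < w.im := im_denom_pos d z
  have hw0 : w ≠ 0 := by rintro h; rw [h] at hw_im; simp at hw_im
  have hdet : (a : ℂ) * d - b * c = 1 := by
    have := det_eq_one' γ
    rw [hc] at this
    exact_mod_cast this
  -- `τ = -2c/w ∈ ℍ`
  set τ : ℂ := -2 * c / w with hτ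
  have hτ_im : 0 < τ.im := by
    rw [hτ, show -2 * (c : ℂ) / w = ((-2 * c : ℝ) : ℂ) * w⁻¹ by push_cast; ring, Complex.mul_im]
    simp only [ofReal_re, ofReal_im, zero_mul, add_zero, inv_im]
    have : 0 < Complex.normSq w := Complex.normSq_pos.mpr hw0
    have : (-2 * (c : ℝ)) * (-w.im / Complex.normSq w) = 2 * c * (w.im / Complex.normSq w) := by ring
    rw [this]
    positivity
  have hτ0 : τ ≠ 0 := by rintro h; rw [h] at hτ_im; simp at hτ_im
  have hIτ : -I * τ = 2 * I * c / w := by rw [hτ]; field_simp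
  have hinvτ : -1 / τ = w / (2 * c) := by rw [hτ]; field_simp
  -- the coordinate of `γ • z`
  have hγz : ((γ • z : ℍ) : ℂ) = a / c - 1 / (c * w) := by
    rw [coe_smul_eq', ← ha, ← hb, ← hd, hc]
    push_cast
    rw [moebius_eq_sub_inv' hc0 hdet hw0]
  -- the terms of `θ(γz)` on the class `n = m c + r`
  have hterm : ∀ (m : ℤ) (r : ℕ),
      cexp (2 * Real.pi * I * ((m * c + r : ℤ) : ℂ) ^ 2 * ((γ • z : ℍ) : ℂ)) =
        cexp (2 * Real.pi * I * ((a * r ^ 2 : ℤ) : ℂ) / c) *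
          cexp (Real.pi * I * τ * (m + (r : ℂ) / c) ^ 2) := by
    intro m r
    rw [← Complex.exp_add, hγz]
    refine cexp_eq_cexp_of_sub_eq (a * (m ^ 2 * c + 2 * m * r)) ?_
    rw [hτ]
    push_cast
    field_simp
    ring
  -- Poisson summation on each class
  have hfib : ∀ r : Fin c, HasSum (fun m : ℤ ↦
      cexp (2 * Real.pi * I * ((m * c + (r : ℕ) : ℤ) : ℂ) ^ 2 * ((γ • z : ℍ) : ℂ)))
      (cexp (2 * Real.pi * I * ((a * (r : ℕ) ^ 2 : ℤ) : ℂ) / c) *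
        (1 / (-I * τ) ^ (1 / 2 : ℂ) * jacobiTheta₂ ((r : ℕ) / c) (-1 / τ))) := by
    intro r
    simp_rw [hterm]
    exact (hasSum_cexp_sq_add hτ_im _).mul_left _
  -- reindex `ℤ` by `Fin c × ℤ`, `(r, m) ↦ m c + r`
  have htot := hasSum_shimuraTheta (γ • z)
  let e : Fin c × ℤ ≃ ℤ := (Equiv.prodComm _ _).trans (Int.divModEquiv c).symm
  have he : ∀ p : Fin c × ℤ, e p = p.2 * c + (p.1 : ℕ) := fun p ↦ rfl
  rw [← e.hasSum_iff] at htot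
  have htot' : HasSum (fun p : Fin c × ℤ ↦
      cexp (2 * Real.pi * I * ((p.2 * c + (p.1 : ℕ) : ℤ) : ℂ) ^ 2 * ((γ • z : ℍ) : ℂ)))
      (shimuraTheta (γ • z)) := by
    convert htot using 2 with p
    simp only [Function.comp_apply, he, Int.cast_add, Int.cast_mul, Int.cast_natCast]
  have hsum := htot'.prod_fiberwise hfib
  rw [← (hasSum_fintype _).unique hsum]
  -- now swap the finite sum over `r` with the series over `k`
  simp_rw [hIτ, hinvτ]
  have hk : ∀ r : Fin c, HasSum (fun k : ℤ ↦
      cexp (2 * Real.pi * I * ((a * (r : ℕ) ^ 2 : ℤ) : ℂ) / c) *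
        (1 / (2 * I * c / w) ^ (1 / 2 : ℂ) * jacobiTheta₂_term k ((r : ℕ) / c) (w / (2 * c))))
      (cexp (2 * Real.pi * I * ((a * (r : ℕ) ^ 2 : ℤ) : ℂ) / c) *
        (1 / (2 * I * c / w) ^ (1 / 2 : ℂ) * jacobiTheta₂ ((r : ℕ) / c) (w / (2 * c)))) := by
    intro r
    exact ((hasSum_jacobiTheta₂_term _ (im_div_two_mul_pos hw_im)).mul_left _).mul_left _
  have hK := hasSum_sum (s := (Finset.univ : Finset (Fin c))) fun r _ ↦ hk r
  rw [← hK.tsum_eq, ← tsum_mul_left]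
  refine tsum_congr fun k ↦ ?_
  rw [quadGaussSum_eq_sum_range, ← Fin.sum_univ_eq_sum_range, Finset.mul_sum, Finset.mul_sum]
  refine Finset.sum_congr rfl fun r _ ↦ ?_
  rw [jacobiTheta₂_term]
  have : cexp (2 * Real.pi * I * ((a * (r : ℕ) ^ 2 : ℤ) : ℂ) / c) *
      cexp (2 * Real.pi * I * k * ((r : ℕ) / c) + Real.pi * I * k ^ 2 * (w / (2 * c))) =
      cexp (Real.pi * I * k ^ 2 * (w / (2 * c))) *
        cexp (2 * Real.pi * I * ((a * (r : ℕ) ^ 2 + k * (r : ℕ) : ℤ) : ℂ) / c) := by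
    rw [← Complex.exp_add, ← Complex.exp_add]
    congr 1
    push_cast
    ring
  rw [mul_left_comm, this]

/-- **The theta multiplier on `Γ₀(4)` with unevaluated Gauss sum (★★).** For
`γ = (a b; c d) ∈ SL₂(ℤ)` with `c > 0`, `4 ∣ c`, and `z ∈ ℍ`:
`θ(γz) = (2ic/(cz + d))^{-1/2} G(a; c) θ(z)`, `G(a; c) = ∑_{r mod c} e(a r²/c)`: in (★) the terms
with `k` odd vanish (`quadGaussSum_eq_zero_of_odd`) and for `k = 2l`,
`exp(πi (2l)² (cz+d)/(2c)) G(a, 2l; c) = e(l² z) e(d l²/c) G(a, 2l; c) = e(l² z) G(a; c)`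
(`stdAddChar_mul_quadGaussSum_two_mul`, `ad ≡ 1 (mod c)`). Squaring, `θ(γz)² = (cz + d) ·
(G(a; c)²/(2ic)) θ(z)²` exhibits `θ²|γ` for the weight-`1` action; the constant `G(a;c)²/(2ic)` is
`χ₋₄(d)` (sequel). [cite: Shimura1973HalfIntegral, §1] [cite: KoblitzECMF1993, Ch. IV §1] -/
theorem shimuraTheta_smul_eq_of_four_dvd {γ : SL(2, ℤ)} (hc : (γ 1 0 : ℤ) = c) (h4 : 4 ∣ c)
    (z : ℍ) :
    shimuraTheta (γ • z) =
      1 / (2 * I * c / ((c : ℂ) * z + γ 1 1)) ^ (1 / 2 : ℂ) * quadGaussSum c (γ 0 0) 0 *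
        shimuraTheta z := by
  rw [shimuraTheta_smul_eq_tsum hc z]
  set a : ℤ := γ 0 0 with ha
  set d : ℤ := γ 1 1 with hd
  set w : ℂ := (c : ℂ) * z + d with hw
  have hc0 : (c : ℂ) ≠ 0 := Nat.cast_ne_zero.mpr (NeZero.ne c)
  have had : (a : ZMod c) * (d : ZMod c) = 1 := by
    have h1 := det_eq_one' γ
    rw [hc, ← ha, ← hd] at h1
    have : ((a * d - γ 0 1 * c : ℤ) : ZMod c) = ((1 : ℤ) : ZMod c) := by rw [h1]
    push_cast at this
    rw [ZMod.natCast_self, mul_zero, sub_zero] at this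
    exact this
  -- even terms
  have heven : HasSum (fun l : ℤ ↦ cexp (Real.pi * I * ((2 * l : ℤ) : ℂ) ^ 2 * (w / (2 * c))) *
      quadGaussSum c a ((2 * l : ℤ) : ZMod c)) (quadGaussSum c a 0 * shimuraTheta z) := by
    have h := (hasSum_shimuraTheta z).mul_left (quadGaussSum c a 0)
    have hf : (fun l : ℤ ↦ cexp (Real.pi * I * ((2 * l : ℤ) : ℂ) ^ 2 * (w / (2 * c))) *
        quadGaussSum c a ((2 * l : ℤ) : ZMod c)) =
        fun l : ℤ ↦ quadGaussSum c a 0 * cexp (2 * Real.pi * I * l ^ 2 * (z : ℂ)) := by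
      funext l
      have e1 : cexp (Real.pi * I * ((2 * l : ℤ) : ℂ) ^ 2 * (w / (2 * c))) =
          cexp (2 * Real.pi * I * l ^ 2 * (z : ℂ)) *
            cexp (2 * Real.pi * I * ((d * l ^ 2 : ℤ) : ℂ) / c) := by
        rw [← Complex.exp_add]
        congr 1
        rw [hw]; push_cast; field_simp
      have e2 : cexp (2 * Real.pi * I * ((d * l ^ 2 : ℤ) : ℂ) / c) =
          (ZMod.stdAddChar ((d : ZMod c) * (l : ZMod c) ^ 2) : ℂ) := by
        rw [← Int.cast_pow, ← Int.cast_mul, ← ZMod.stdAddChar_coe]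
      rw [e1, e2, mul_assoc, show ((2 * l : ℤ) : ZMod c) = 2 * (l : ZMod c) by push_cast; ring,
        stdAddChar_mul_quadGaussSum_two_mul _ _ _ had, mul_comm]
    rw [hf]
    exact h
  -- odd terms vanish
  have hodd : HasSum (fun l : ℤ ↦ cexp (Real.pi * I * ((2 * l + 1 : ℤ) : ℂ) ^ 2 * (w / (2 * c))) *
      quadGaussSum c a ((2 * l + 1 : ℤ) : ZMod c)) 0 := by
    have hf : (fun l : ℤ ↦ cexp (Real.pi * I * ((2 * l + 1 : ℤ) : ℂ) ^ 2 * (w / (2 * c))) *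
        quadGaussSum c a ((2 * l + 1 : ℤ) : ZMod c)) = fun _ ↦ 0 := by
      funext l
      rw [quadGaussSum_eq_zero_of_odd h4 _ ⟨l, rfl⟩, mul_zero]
    rw [hf]
    exact hasSum_zero
  have := hasSum_int_even_add_odd
    (f := fun k : ℤ ↦ cexp (Real.pi * I * k ^ 2 * (w / (2 * c))) * quadGaussSum c a k) heven hodd
  rw [this.tsum_eq, add_zero]
  ring

end Transform

end Literature.NumberTheory.EllipticCurves.ModularForms
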